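import Mathlib.RingTheory.Kaehler.Basic
import Mathlib.RingTheory.KrullDimension.Basic
import Mathlib.RingTheory.IntegralClosure.IntegrallyClosed
import Mathlib.RingTheory.FiniteType
import Mathlib.RingTheory.Localization.Defs
import Mathlib.FieldTheory.Perfect
import Literature.RingTheory.FittingIdeal.Basic
import Literature.RingTheory.FittingIdeal.Etale
import Literature.RingTheory.CohomologyAnnihilator.Basic
import Literature.RingTheory.CohomologyAnnihilator.Localization
import HarnessLib

/-!
# The Jacobian ideal annihilates `Ext^{d+1}` (Iyengar–Takahashi 2016, Theorem 1.2)

Topic: `Literature/RingTheory/CohomologyAnnihilator`.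

S. B. Iyengar and R. Takahashi, *The Jacobian ideal of a commutative ring and annihilators of
cohomology*, J. Algebra **571** (2021), doi:10.1016/j.jalgebra.2018.07.034 = arXiv:1610.02599
(bib key `IyengarTakahashi2016`; the locators below are those of the held arXiv text).

## The printed statements (read on the page)

* **Theorem 1.2** (Introduction; = **Theorem 3.8** in the body). *Let `R` be an affine algebra over
  a field, or an equicharacteristic complete local ring, of Krull dimension `d`. If `R` is
  equidimensional and `2 · depth R_𝔭 ≥ dim R_𝔭` for each `𝔭 ∈ Spec R`, then for all `R`-modules
  `M, N` one has `jac(R) · Ext^{d+1}_R(M, N) = 0`.* (Theorem 3.8 states the same conclusion for any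
  commutative noetherian ring `R` of Krull dimension `d` with these two hypotheses, for the ideal
  `jac(R)` of §3.)
* **Definition of `jac(R)`** (§3, "Jacobian ideal"): `jac(R) := Σ_{A ⊆ R} 𝔡_K(R/A)`, the sum of
  the Kähler differents `𝔡_K(R/A) := Fitt₀^R(Ω_{R/A})` over all Noether normalizations `A ⊆ R`.
* **Example 3.2.** *If `R` is an affine algebra over a field `k`, then `jac(R)` is the classical
  Jacobian ideal of the `k`-algebra `R`, namely `jac(R) = Fitt_d^R(Ω_{R/k})` where `d = dim R`.*
  (Read with the Introduction p.3 L18, «for affine domains over a perfect field» [Wang98]: the equality is a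
  PERFECT-field statement — over an imperfect `k` it fails for `R = k[y]/(y^p − a)`, `a ∉ k^p` — so the fact
  below assumes `[PerfectField k]`.)
  (Fitting invariants as in Bruns–Herzog p. 21, i.e. `Fitt_d` = the ideal of `(n - d)`-minors of a
  presentation on `n` generators — the convention of the tree's
  `Literature.RingTheory.FittingIdeal.Module.fittingIdeal`.)
* **"`I` annihilates `Extⁿ_R(−,−)`"** (§3, "Annihilators of Ext") means `I · Extⁿ_R(M, N) = 0` for
  ALL `R`-modules `M, N` (not necessarily finitely generated), equivalently `I · Ext^{≥ n}_R = 0`.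
  In particular such an `I` lies in the tree's `cohomologyAnnihilatorOfDegree R n = caⁿ(R)`
  (`ann Ext^{≥ n}` on finitely generated modules, [IyengarTakahashi2014, Def. 2.1]).
* **Equidimensional** (before Lemma 3.7): the Krull dimension of `R/𝔮` is the same finite number
  for every minimal prime `𝔮` of `R`.

## What this file vendors

ONE statement-only named fact, the special case the consumer needs (no `depth` /
equidimensionality vocabulary exists in Mathlib or the tree today, so the general form is not
stated — `TODO(general form)` below):

* `jacobianFloor_normal_dim3 k` (FACT-LIST label **F-89a**, «composite (4 links)»; typer res-L1-s13-pv-1 on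
  res-D-lit-1's farm-checked hand-over, c3 reader res-D-lit-1, desk res-dag-4) — for a finitely generated
  `k`-algebra `B` which is a NORMAL DOMAIN of Krull dimension `3`: `Fitt₃(Ω[B⁄k]) ≤ ca⁴(B)`.

COMPOSITE-FACT CHAIN (director-resolution RULING (P2), four links, each a citation + one routine step):
(1) [IyengarTakahashi2016, Thm 1.2 p.3 L22–31 = Thm 3.8 p.8 L59–66]: affine `R` over a field, Krull dim `d`,
equidimensional, `2·depth R_𝔭 ≥ dim R_𝔭` ∀ `𝔭` ⇒ `jac(R)·Ext^{d+1}_R(M,N) = 0` for ALL `M, N` (exponent ONE);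
(2) [IyengarTakahashi2016, Ex. 3.2 p.7 L52–58, citing Wang98 — the PERFECT-field setting, cf. p.3 L18 «for affine domains over a perfect
field»]: for affine `R` over a PERFECT field `k`, `jac(R) = Fitt_d^R(Ω_{R/k})` — hence the typed fact carries `[PerfectField k]` (over an
imperfect `k` the equality fails already for `R = k[y]/(y^p − a)`, `a ∉ k^p`: `jac(R) = R` but `Fitt₀(Ω_{R/k}) = 0`; reviewer q11914695);
(3) equidimensionality [IyengarTakahashi2016, p.8 L14, their definition]: a DOMAIN has one minimal prime, hence is
equidimensional; (4) Serre's criterion [Matsumura1987, Thm 23.8]: a noetherian normal domain is `(S₂)`, i.e.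
`depth B_𝔭 ≥ min(2, dim B_𝔭)`, so `2·depth B_𝔭 ≥ dim B_𝔭` whenever `dim B_𝔭 ≤ 4` — always when `dim B = 3`.
Plus the reading [IyengarTakahashi2016, p.7 L80–86]: «`I` annihilates `Ext^{d+1}(−,−)` for all modules» ⇒
`I ≤ ca^{d+1}` (`cohomologyAnnihilatorOfDegree`, [IyengarTakahashi2014, Def. 2.1]).

Derivation of the printed hypotheses in this special case (all textbook): a domain has a single
minimal prime, so it is equidimensional; a noetherian normal domain satisfies Serre's condition
`(S₂)`, `depth B_𝔭 ≥ min(2, dim B_𝔭)` [Matsumura1987, Thm 23.8], whence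
`2 · depth B_𝔭 ≥ dim B_𝔭` as soon as `dim B_𝔭 ≤ 4`, in particular throughout a ring of Krull
dimension `3`; `jac(B) = Fitt₃(Ω[B⁄k])` by Example 3.2; and `jac(B) · Ext⁴_B(M, N) = 0` for all
`M, N` gives membership in `ca⁴(B)` as recalled above. The typed statement is therefore a
COROLLARY of the printed theorem (narrower, never wider).

Proved in the companion file `JacobianIdealAnnihilatorLemmas.lean` (no new facts; kept out of this STATEMENT-ONLY file): the
elementwise unfolding `…smul_ext_eq_zero` and the transport to localisations `…of_isLocalization` (Fitting ideals of Kähler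
differentials localise, `Module.fittingIdeal_kaehlerDifferential_of_isLocalization'`; `caⁿ(B)·T ⊆ caⁿ(T)`,
[IyengarTakahashi2014, Lemma 2.10(1)] = `map_cohomologyAnnihilatorOfDegree_le_of_isLocalization`).

NOT vendored: Theorem 1.1 / 3.4 (the `jac(R)^s` version), Corollary 3.5, Corollary 3.9, the
complete-local case (Example 3.3), and the derived Noether different of §2.

## References

* [IyengarTakahashi2016] S. B. Iyengar, R. Takahashi, *The Jacobian ideal of a commutative ring and
  annihilators of cohomology*, J. Algebra 571 (2021); arXiv:1610.02599 — Thm 1.2, Thm 3.8, Ex. 3.2.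
* [IyengarTakahashi2014] S. B. Iyengar, R. Takahashi, *Annihilation of cohomology and strong
  generation of module categories*, IMRN 2016 — Def. 2.1, Lemma 2.10(1).
* [Matsumura1987] H. Matsumura, *Commutative Ring Theory*, Thm 23.8 (Serre's criterion).
-/

noncomputable section

open CategoryTheory CategoryTheory.Abelian
open Literature.RingTheory.FittingIdeal

universe u

namespace Literature.RingTheory.CohomologyAnnihilator

/-- **Named fact — Iyengar–Takahashi 2016, Theorem 1.2 (= Theorem 3.8) with Example 3.2, in the
special case of a normal affine domain of dimension `3`.** Printed: *Let `R` be an affine algebra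
over a field of Krull dimension `d`. If `R` is equidimensional and `2 · depth R_𝔭 ≥ dim R_𝔭` for
each `𝔭 ∈ Spec R`, then `jac(R) · Ext^{d+1}_R(M, N) = 0` for all `R`-modules `M, N`*, where for an
affine `k`-algebra over a PERFECT field `k`, `jac(R) = Fitt_d^R(Ω_{R/k})` (Example 3.2, [Wang98]; p.3 L18). Here: for a
PERFECT field `k` (`[PerfectField k]` — consumers work in characteristic `0`) and every finitely generated
`k`-algebra `B` which is a normal domain (`IsDomain B`, `IsIntegrallyClosed B`) of Krull dimension
`3` — so that `B` is equidimensional and, by Serre's `(S₂)` [Matsumura1987, Thm 23.8],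
`2 · depth B_𝔭 ≥ dim B_𝔭` for every `𝔭` — the Jacobian ideal `Fitt₃(Ω[B⁄k])` kills `Extⁱ_B(M, N)`
for all `i ≥ 4` and all finitely generated `M, N`, i.e. `Fitt₃(Ω[B⁄k]) ≤ ca⁴(B)`
(`cohomologyAnnihilatorOfDegree B 4`). Statement-only: users take
`(h : jacobianFloor_normal_dim3 k)`. This is the text `JacobianFloorNormal3 k` of
the requesting route (W4.4, NEED-FACT (J)), universe-polymorphic in one universe `u`.
FACT-LIST F-89a «composite (4 links)»: IT2016 Thm 1.2 (p.3 L22–31) + Ex. 3.2 (p.7 L52–58, jac = Fitt_d Ω over a PERFECT field,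
[Wang98], p.3 L18) + equidimensionality of domains (p.8 L14) + Serre (S₂) [Matsumura1987, Thm 23.8] ⇒ 2·depth ≥ dim
when dim ≤ 4; every close through it is ‖ K·F.
-- TODO(general form): equidimensional `R` of dimension `d` with `2·depth R_𝔭 ≥ dim R_𝔭` ⇒
-- `Fitt_d(Ω[R⁄k]) ≤ ca^{d+1}(R)`, once `depth` is available.
[cite: IyengarTakahashi2016, Thm 1.2 (= Thm 3.8) and Ex. 3.2] -/
def jacobianFloor_normal_dim3 (k : Type u) [Field k] [PerfectField k] : Prop :=
  ∀ (B : Type u) [CommRing B] [IsDomain B] [Algebra k B],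
    Algebra.FiniteType k B → IsIntegrallyClosed B → ringKrullDim B = 3 →
      Module.fittingIdeal B (Ω[B⁄k]) 3 ≤ cohomologyAnnihilatorOfDegree B 4


end Literature.RingTheory.CohomologyAnnihilator
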